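import Summits.NavierStokesRegularity.FunctionalMining.NoGo.TopBotEigHeatCoerciveTwo
import HarnessLib

/-!
# FunctionalMining — the SHARP pointwise comparison `|S|² ≤ 6 λ₁²` for divergence-free strains on `T³`

Search for candidate a priori estimates; no regularity claim. Cell `pub-nsfunc`, prove seat (gen 26).
The tree's comparison of the strain with its top eigenvalue is `|S| ≤ 6λ₁` (`TopEig.norm_strainFlat_le`,
whence `∑ᵢⱼ Sᵢⱼ² ≤ 36λ₁²`, `sum_sq_strainEntry_le`, used in the L-λ(η) assemblies with the factor `36`). The
sharp constant is `6`: for a trace-free symmetric `3 × 3` matrix with sorted eigenvalues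
`λ₁ ≥ λ₂ ≥ λ₃`, `λ₁ + λ₂ + λ₃ = 0` forces `−λ₁/2 ≤ λ₂ ≤ λ₁`, hence
`|S|² = λ₁² + λ₂² + λ₃² = 2λ₂² + 2λ₁λ₂ + 2λ₁² ≤ 6λ₁²` (equality at `λ = (1, 1, −2)`, the biaxial point).

* `torusStrainSqAt_le_six_mul_topEig_sq` — `|S(x)|² ≤ 6 λ₁(x)²` for smooth divergence-free `v` on `T³`;
* `sum_sq_strainEntry_le_six` — the same for `∑ᵢⱼ (torusStrainMatrix v x i j)²`.

(With `6` in place of `36`, the `q = 2` rate of `TopEigGapCoerciveTwo` would improve from `2π²η/9` to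
`4π²η/3`; not re-filed — bookkeeping only.) [ours; folklore linear algebra]
-/

noncomputable section

open Finset

namespace Summit.NavierStokesRegularity.FunctionalMining

open Literature.Analysis Literature.Analysis.FunctionSpaces

namespace TopEig

variable {v : UnitAddTorus (Fin 3) → EuclideanSpace ℝ (Fin 3)}

/-- **`|S(x)|² ≤ 6 λ₁(x)²`** for a smooth divergence-free field on `T³` (sharp; equality at the biaxial
point `λ = (1, 1, −2)`). [ours; folklore] -/
theorem torusStrainSqAt_le_six_mul_topEig_sq (hv : Torus.IsSmooth v) (hdiv : Torus.IsDivFree v)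
    (x : UnitAddTorus (Fin 3)) : torusStrainSqAt v x ≤ 6 * torusStrainTopEig v x ^ 2 := by
  rw [torusStrainSqAt_eq_eig3, torusStrainTopEig_eq_eig3]
  have hsum := eig3_sum_eq_zero hv hdiv x
  have h01 : eig3 v x 1 ≤ eig3 v x 0 := eig3_antitone v x (show (0 : Fin 3) ≤ 1 by decide)
  have h12 : eig3 v x 2 ≤ eig3 v x 1 := eig3_antitone v x (show (1 : Fin 3) ≤ 2 by decide)
  -- `λ₃ = −λ₁ − λ₂`, `λ₂ ≥ λ₃ ⇒ 2λ₂ ≥ −λ₁`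
  have h3 : eig3 v x 2 = -eig3 v x 0 - eig3 v x 1 := by linarith
  rw [h3]
  nlinarith [h01, h12]

/-- **`∑ᵢⱼ Sᵢⱼ(x)² ≤ 6 λ₁(x)²`** — the same for the entries of `torusStrainMatrix`. [ours; folklore] -/
theorem sum_sq_strainEntry_le_six (hv : Torus.IsSmooth v) (hdiv : Torus.IsDivFree v) (x : UnitAddTorus (Fin 3)) :
    ∑ i, ∑ j, (torusStrainMatrix v x i j) ^ 2 ≤ 6 * torusStrainTopEig v x ^ 2 := by
  have h := torusStrainSqAt_le_six_mul_topEig_sq hv hdiv x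
  have e : ∑ i, ∑ j, (torusStrainMatrix v x i j) ^ 2 = torusStrainSqAt v x := by
    simp only [torusStrainSqAt, torusStrainMatrix, Matrix.of_apply]
  rw [e]
  exact h

end TopEig

end Summit.NavierStokesRegularity.FunctionalMining

end
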